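import Summits.ABC.IUTFork.Repair.RHHeightScaling
import Summits.ABC.IUTFork.Repair.RHAxisCK1Spec
import Summits.ABC.IUTFork.Repair.RHAxisCK1RequirementsB
import Summits.ABC.IUTFork.Repair.RHIsoThetaFaces
import Literature.AnabelianGeometry.EtaleTheta.ClassicalThetaProduct
import HarnessLib

/-!
# R-H ROUND 4, R4-3 IDEATION CELL — THE TYPER'S FILE: (§0) the cell-currency FOOTPRINT of an ideation object and «it meets the κ₁ spec `SpecK1`»,
# with its height-ray profiles for the D2 class statement; (§n) one section per SURVIVING object (§1: the isogenous theta)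

abc-iut cell, rung LADDER-ABC:A2.RESCUE.H; seat abc-iut-rh4-typ-1 (GEN 0), KEY `wake/KEY-abc-iut-rh4-typ-1-R4IDEA-TYPE.md` 2342d1cdeb6caa1f (abc-iut-rh-lead g5
2026-08-27T13:48:10Z; director-abc g6-D5 «REPOINT GO» 13:43:52Z; HUMAN D-0133 · D-0134 · D-0135); task of record `plan/rescue/R-H/ROUND4/R4-TASKS.md` v1 row 29;
census `plan/rescue/R-H/ROUND4/OPENINGS-CENSUS.md` (sole writer rh-lead; rows O-01…O-05 = the five κ₁ doors `(κ′, μ₀) ∈ {(1, 27/64), (1, ½), (1, ¾), (3/2, 27/64),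
(3/2, ½)}`, LIVE = untested — DATA-INERT per R4-1; rows O-31… = the ideation cards); referee rh-ref-2; falsifier seats rh4-crit-1 / rh4-crit-2; card authors rh4-id-1…4.
ROUND-4 MODEL: INSTRUMENT FIRST (an object is typed only after its falsifier ran); PROOF MASS = DELTA (stands-on BY NAME; residual as a `Prop`). Companion faces filed
by this seat for the refuters (crit bytes verbatim): p538071 `RHAxisCK1ValueLawNoGo` · p538652 · p539331 · p539860 `RHBiextSliceFaces` · p541305 `RHIsoThetaFaces`.

WHAT IS TYPED (namespace `Summit.ABC.IUTFork.Repair.RH.Round4Objects`; plain `def`/`structure`, no instance, no notation; imports BY NAME p532994 `RHHeightScaling`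
(`NegExponent` · `DoorAt`), p538398 `RHAxisCK1Spec` (`SpecK1 a μ₀ … ord dem licensed`, `ordOf`, `demOf`, `specK1_iff`), p534392/p536146 `RHAxisCK1Requirements(B)`
(`R1_licenceLaw` · `R1_meets`), the k1 currency p506542/p508156/p521933/p522952 (`Cell` · `lawPow` · `margin` · `exactDeficit` · `demandSum` · `reqMass` · `datumDeficit`),
`RHIsoThetaFaces` p541305 (`norm_isoTheta_abs`), `…EtaleTheta.ClassicalThetaProduct` (`thetaDdot_eq_zero_iff_of_norm_lt_one`); the O-34 PLACEMENT statement
`DoorThm110At` lives in the sibling `RHRound4DoorPlacement.lean`):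
* §0 THE FOOTPRINT OF AN OBJECT IN CELL CURRENCY (shared by every object section). Whatever a card's construction is (a re-weighted tensor packet, another
  evaluation locus or section, an indexing, a period lattice, a height), it enters this cell ONLY through what its Θ-pilot / log-volume computation would OUTPUT
  per cell `(w, j)` (REQB-SPEC v0.2 §1; `SpecK1`'s (O1)–(O3)): a PILOT-ORDER LAW `law j` in units `m_q/den` — the demand `(law j − den)·m_q/den` moves WITH it —
  and the integer MARGIN its indeterminacy terms leave at integer place data `(e, m_q, D, R_in, R_out)` (licensed ⟺ margin ≥ 0; print and every pure weight-law
  object: `ReqsideWeightLaws.margin law den`). `Output` := that triple; `Output.ofLaw f den` (pure k1 footprint), `Output.print` (`j²`), `Output.doorTarget a` (the bare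
  law `⌈j^{a/2}⌉` the doors DEMAND — a target, not an object); per datum its SpecK1-outputs `ordAt` / `demAt` / `licensedAt` and **`MeetsSpecK1 a μ₀ O ⟨datum⟩ :=
  SpecK1 a μ₀ ⟨datum⟩ (O.ordAt m) (O.demAt m) (O.licensedAt …)`** (p538398 BY NAME; `den = 1` footprints — every κ₁ door is `den = 1`); per place `keptDemand` (tier L0) /
  `exactDeficit` (tier L1); along the HEIGHT RAY `m_q ↦ t·m_q` (places, `l`, `u_w` fixed — p532994/p531802's dilation) the masses `massAt` · `keptL0At` · `keptL1At`
  and the recovered-fraction PROFILES `profileL0/L1 : ℝ → ℝ` read at the integer dilation `t = ⌊s⌋₊` (the engines use rational `s` with floor after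
  multiplication — a modelling choice); D2 CLASS STATEMENT = `NegExponent (O.profileL1 ⟨datum⟩)` (KILLED shape) or `DoorAt (…)`. Calibrations `licensed_ofLaw_iff`,
  `exactDeficit_ofLaw`, `meetsSpecK1_doorTarget_iff` (the target meets (O1)–(O4) of its own door; what remains is EXACTLY the MEETS word `R1_meets a μ₀`).
* §1 CARD `isogenous-theta-first-power` (rh4-id-1, lens 1; card 43cf8ba6c06ec9a5; verdict rh4-crit-1 cb6fdd389d094aeb: «law |j| at print's points, first power,
  even» CERTIFIED · «outside the no-go» SURVIVES · door LIVE as NEW-THEORY k0 · not a rescue alone; census O-35 and the object column of O-01/O-02/O-03): the OBJECT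
  at value level `isoTheta q̈ N := Θ̈_{q̈^N}` (the [EtTh] Prop 1.4 series of the `N`-isogenous Tate curve `𝔾_m/q^{Nℤ}`, read at print's UNCHANGED label points
  `q̈^j·ζ`); the card's RE-CUT value-level requirement `R4_valueLawSub k N q̈ F` (zeros exactly at `±(q̈^N)^ℤ` · print's `k = 4` factor of automorphy for the PERIOD
  lattice `(q̈^N)^ℤ` · ABSOLUTE value law `‖F(q̈^j ζ)‖ = ‖q̈‖^{−⌈|j|^{k/2}⌉}` on the LABEL lattice `0 < |j| < N`) with print as its `(4, 1)` member
  (`valueLawSub_four_one_of_valueLaw_four`) and its INHABITATION at `(2, l)` by `isoTheta q̈ l` PROVED over every complete ultrametric field (`isoTheta_valueLawSub`: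
  tree `thetaDdot_eq_zero_iff_of_norm_lt_one` + `R4_valueLaw_four_automorphy_thetaDdot` + crit-1's `IsoThetaFaces.norm_isoTheta_abs` p541305) — whereas the
  full-lattice requirement `R4_valueLaw 2` is UNINHABITED (`AxisCK1ValueLawNoGo.not_valueLaw_two`, p538071); the cell footprint `isoThetaFirstPower := Output.doorTarget 2`
  (law `|j|`, `den = 1`, print margins — packets / labels / processions / log-shells UNCHANGED per the card's dictionary), `isoThetaFirstPower_meetsSpec` (=
  `MeetsSpecK1 2 μ₀` ∧ the value-level requirement realised; `_iff`: ↔ the MEETS word `R1_meets 2 μ₀`) and `isoThetaFirstPower_classStatement` (= `NegExponent` of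
  its exact-tier profile — KILLED shape EXPECTED: weights-only, BARRIER p531802 / EXP-6 p533167 verbatim; the card claims no rescue). NOT TYPABLE, reported as
  census facts: R-A2 (cusp-filling quotient `Π^tp_X ↠ Π^tp_{X′}` — no carrier in the tree) and R-A3 (a Cor 2.8-type restriction algorithm for ONE factor of the
  `F_l`-norm under the label-0-moving Δ_C-conjugation of [IUTchII] Cor 3.5 (i) — no carrier) — the load-bearing NEW-THEORY k0 residuals of the door.
* §n (n ≥ 2): further surviving objects, one section each; untypable dictionaries are reported on STATUS, never given a section. At this cut (census
  v0.11): O-31/O-32 KILLED (faces p538652/p539331), O-33 KILLED ×2 + corner «oriented labels ∧ R-b2» → round 2 (carrier `BiextSliceFaces.biextSlice` p539860), O-36 pending.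
HONEST FRAMING / GUARDS: every `def … : Prop` here is a HYPOTHESIS in OUR typed cell currency about a HYPOTHETICAL object or a door's downstream SHAPE — typed so that it can
be attacked or proved, never a reading of [EtTh]/[IUTchI–IV], never a claim that the object exists or that the inequality holds, NEVER a Literature fact (no new `Prop`
fact; inputs ⊆ the frozen FACT-LIST f75a60bac22efdb6 + the landed modules imported above); SURVIVES (a falsifier did not bite) ≠ holds; typed ≠ proved; computed ≠ proved;
located ≠ adjudicated; nothing here asserts that abc is proved or refuted, or takes a side on [IUTchIII] Cor. 3.12 / Rmk. 3.9.x / [IUTchIV] Thm. 1.10 or on any author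
(D-0045). [claim: Mochizuki2012, status: disputed] for every IUT locution. [cite: Mochizuki2012, IUTchIII Cor. 3.12 p. 173–174, Rmk. 3.9.3 p. 119–120; IUTchIV Prop. 1.4
p. 13, Thm. 1.10 Step (v)–(viii) p. 27–29, Cor. 2.2 p. 45–46] [cite: Vojta1987, Conj. 5.7.5 p. 61–62, 5.A.2 p. 64]
-/

noncomputable section

open Finset

namespace Summit.ABC.IUTFork.Repair.RH.Round4Objects

open Summit.ABC.IUTFork.Repair.RH.ReqsideWeightLaws Summit.ABC.IUTFork.Repair.RH.AxisCK1Requirements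
open Summit.ABC.IUTFork.Repair.RH.AxisCK1Spec Summit.ABC.IUTFork.Repair.RH.HeightScaling

/-! ## §0. The footprint of an R4-3 object in cell currency; «meets `SpecK1`»; height-ray profiles -/

/-- **THE CELL-CURRENCY FOOTPRINT OF AN OBJECT** — what the card's Θ-pilot / log-volume computation would OUTPUT per cell (REQB-SPEC v0.2 §1; `SpecK1` (O1)–(O3),
p538398): the PILOT-ORDER LAW `law j` at label `j` in units `m_q/den` (print `j²`, `den = 1`; the cell's DEMAND is `(law j − den)·m_q/den` and moves WITH the pilot
order — k1), the pilot denominator `den`, and the integer MARGIN its indeterminacy / rounding terms leave at integer place data `(e, m_q, D, R_in, R_out)` and label `j`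
(print: `m − (j+1)R_out − e·⌊(j²m − jD − (j+1)R_in)/e⌋`; the cell is LICENSED iff the margin is `≥ 0` — k3 at whatever setting the object induces). Everything upstream
of this triple (species, indexings, period maps, heights) enters the census only through it. A term of this type is a HYPOTHETICAL output, not an IUT object.
[claim: Mochizuki2012, status: disputed] -/
@[claim "Mochizuki2012" "disputed"]
structure Output where
  /-- pilot order at label `j`, units `m_q/den` (print `j ↦ j²`). -/
  law : ℕ → ℤ
  /-- pilot denominator (print `1`; `2` carries half-integer laws). -/
  den : ℤ
  /-- margin at place data `(e, m, δ, r_in, r_out)` and label `j` (licensed ⟺ `0 ≤ margin`). -/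
  margin : ℤ → ℤ → ℤ → ℤ → ℤ → ℕ → ℤ

/-- The object LICENSES the cell at `(e, m, δ, r_in, r_out; j)` iff its margin there is `≥ 0` (engines' `margin_j ≥ 0`). [claim: Mochizuki2012, status: disputed] -/
@[claim "Mochizuki2012" "disputed"]
def Output.Licensed (O : Output) (e m δ rin rout : ℤ) (j : ℕ) : Prop :=
  0 ≤ O.margin e m δ rin rout j

/-- **PURE WEIGHT-LAW FOOTPRINT**: law `f/den` with print's margin terms — the k1 currency's `ReqsideWeightLaws.margin f den` (p521933), whose sign is the
k1-cell `Cell f den` (`licensed_ofLaw_iff`). [claim: Mochizuki2012, status: disputed] -/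
@[claim "Mochizuki2012" "disputed"]
def Output.ofLaw (f : ℕ → ℤ) (den : ℤ) : Output :=
  ⟨f, den, ReqsideWeightLaws.margin f den⟩

/-- PRINT's footprint: law `j²`, `den = 1`, print margins (calibration object; its cell is `HullCellδ`, `cell_sq_iff_hullCellδ`). [claim: Mochizuki2012, status: disputed] -/
@[claim "Mochizuki2012" "disputed"]
def Output.print : Output :=
  Output.ofLaw (fun j => (j : ℤ) ^ 2) 1

/-- **THE DOORS' TARGET LAW** `⌈j^{a/2}⌉` (`lawPow a`, p506542; `a = 2`: κ′ = 1, rows O-01…O-03; `a = 3`: κ′ = 3/2, rows O-04/O-05) with print margins — WHAT a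
κ₁ object must output (R4-2 `SpecK1 a μ₀`), not an object anyone has constructed. [claim: Mochizuki2012, status: disputed] -/
@[claim "Mochizuki2012" "disputed"]
def Output.doorTarget (a : ℕ) : Output :=
  Output.ofLaw (lawPow a) 1

/-- CALIBRATION: the pure-law footprint licenses EXACTLY the k1-cell of record (`cell_iff_margin_nonneg`, p521933). [folklore] -/
theorem Output.licensed_ofLaw_iff (f : ℕ → ℤ) (den e m δ rin rout : ℤ) (j : ℕ) :
    (Output.ofLaw f den).Licensed e m δ rin rout j ↔ Cell f den e m δ rin rout j :=
  (cell_iff_margin_nonneg f den e m δ rin rout j).symm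

/-- **TIER-L0 KEPT DEMAND of the object at a place**, label units: `Σ_{1 ≤ j ≤ L, licensed} (law j − den)` (licence-only, no netting; the k1 currency's
`keptDemand` for pure laws). [claim: Mochizuki2012, status: disputed] -/
@[claim "Mochizuki2012" "disputed"]
def Output.keptDemand (O : Output) (e m δ rin rout : ℤ) (L : ℕ) : ℤ :=
  ∑ i ∈ Finset.range L, if 0 ≤ O.margin e m δ rin rout (i + 1) then O.law (i + 1) - O.den else 0

/-- **TIER-L1 EXACT DEFICIT of the object at a place**: `Σ_{1 ≤ j ≤ L} (−margin_j)⁺` (exact information, no netting; carries the depth `m` like the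
margins). [claim: Mochizuki2012, status: disputed] -/
@[claim "Mochizuki2012" "disputed"]
def Output.exactDeficit (O : Output) (e m δ rin rout : ℤ) (L : ℕ) : ℤ :=
  ∑ i ∈ Finset.range L, max 0 (-(O.margin e m δ rin rout (i + 1)))

/-- CALIBRATION: for a pure law the object's exact deficit IS the k1 currency's `exactDeficit f den` (p521933), literally. [folklore] -/
theorem Output.exactDeficit_ofLaw (f : ℕ → ℤ) (den e m δ rin rout : ℤ) (L : ℕ) :
    (Output.ofLaw f den).exactDeficit e m δ rin rout L = ReqsideWeightLaws.exactDeficit f den e m δ rin rout L :=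
  rfl

section Datum

variable {ι : Type*}

/-- The object's PILOT-ORDER output per cell at a datum with depths `m_w`: `ord w j = law j · m_w` (`SpecK1` (O1) shape; for `den = 1` footprints — every κ₁ door
is `den = 1`). [claim: Mochizuki2012, status: disputed] -/
@[claim "Mochizuki2012" "disputed"]
def Output.ordAt (O : Output) (m : ι → ℤ) : ι → ℕ → ℤ :=
  fun w j => O.law j * m w

/-- The object's DEMAND output per cell: `dem w j = ord w j − m_w` (`SpecK1` (O2): demand and pilot order move together). [claim: Mochizuki2012, status: disputed] -/
@[claim "Mochizuki2012" "disputed"]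
def Output.demAt (O : Output) (m : ι → ℤ) : ι → ℕ → ℤ :=
  fun w j => O.ordAt m w j - m w

/-- The object's LICENCE verdict per cell at the datum's integer place data (`SpecK1` (O3) slot). [claim: Mochizuki2012, status: disputed] -/
@[claim "Mochizuki2012" "disputed"]
def Output.licensedAt (O : Output) (e m δ rin rout : ι → ℤ) : ι → ℕ → Prop :=
  fun w j => O.Licensed (e w) (m w) (δ w) (rin w) (rout w) j

/-- **«THE OBJECT MEETS THE κ₁ SPEC `(κ′ = a/2, μ₀)` AT THE DATUM»** — reqb-typ-1's `SpecK1 a μ₀` (p538398, R4-2) fed with THIS object's outputs (datum = places `s`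
with integer data `(e, m, δ, r_in, r_out)`, place weights `u_w`, `L = l⋆` labels): (O1) its pilot order is `⌈j^{a/2}⌉·m_w`, (O2) its demand moves with it, (O3) its
licence verdict is print's exact U2 hull cell at its order with every margin term at print, (O4) the mass is booked once per cell over the print label set, (O5) the
datum MEETS at `μ₀`. The census residuals R-0nb read «`SpecK1 a μ₀` realised by SOME typed object»: `∃ O, O.MeetsSpecK1 a μ₀ ⟨datum⟩` on the bed. HYPOTHESIS about a
hypothetical object. [claim: Mochizuki2012, status: disputed] -/
@[claim "Mochizuki2012" "disputed"]
def Output.MeetsSpecK1 (a : ℕ) (μ₀ : ℝ) (O : Output) (s : Finset ι) (e m δ rin rout : ι → ℤ) (u : ι → ℝ) (L : ℕ) : Prop :=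
  SpecK1 a μ₀ s e m δ rin rout u L (O.ordAt m) (O.demAt m) (O.licensedAt e m δ rin rout)

/-- CALIBRATION: the bare target `doorTarget a` meets (O1)–(O4) of its own door identically (its outputs ARE `ordOf`/`demOf`, its licence IS the `κ′ = a/2` cell) — what is
left of `MeetsSpecK1` is EXACTLY the datum's MEETS word `R1_meets a μ₀` (p534392; decided on the genuine bed by the faces of record, census rows O-01…O-05: MEETS 133/133 ·
79/79 at all five points). So the content of a card is never (O1)–(O5) — it is the CLASS statement below and the construction upstream of the footprint (`specK1_iff`,
p538398, BY NAME). [folklore] -/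
theorem Output.meetsSpecK1_doorTarget_iff (a : ℕ) (μ₀ : ℝ) (s : Finset ι) (e m δ rin rout : ι → ℤ) (u : ι → ℝ) (L : ℕ) :
    (Output.doorTarget a).MeetsSpecK1 a μ₀ s e m δ rin rout u L ↔ R1_meets a μ₀ s e m δ rin rout u L := by
  have h := specK1_iff a μ₀ s e m δ rin rout u L ((Output.doorTarget a).licensedAt e m δ rin rout)
  have hlic : R1_licenceLaw a s e m δ rin rout L ((Output.doorTarget a).licensedAt e m δ rin rout) :=
    fun w _ j _ _ => Output.licensed_ofLaw_iff (lawPow a) 1 (e w) (m w) (δ w) (rin w) (rout w) j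
  unfold Output.MeetsSpecK1
  exact ⟨fun hS => (h.mp hS).2, fun hM => h.mpr ⟨hlic, hM⟩⟩

/-- **TOTAL REQUIRED MASS of the object's law at the datum dilated by `t`** (`m_q(w) ↦ t·m_q(w)`, places / `l` / `u_w` fixed): `reqMass law den L (Σ_w t·m_w·u_w)`
— linear in `t` (p508156 `reqMass`). [claim: Mochizuki2012, status: disputed] -/
@[claim "Mochizuki2012" "disputed"]
def Output.massAt (O : Output) (s : Finset ι) (m : ι → ℤ) (u : ι → ℝ) (L : ℕ) (t : ℕ) : ℝ :=
  reqMass O.law O.den L (∑ w ∈ s, (t : ℝ) * (m w : ℝ) * u w)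

/-- **TIER-L0 KEPT MASS at dilation `t`**: `Σ_w (keptDemand_w(t·m_w)/den)·(t·m_w)·u_w` (licence-only). [claim: Mochizuki2012, status: disputed] -/
@[claim "Mochizuki2012" "disputed"]
def Output.keptL0At (O : Output) (s : Finset ι) (e m δ rin rout : ι → ℤ) (u : ι → ℝ) (L : ℕ) (t : ℕ) : ℝ :=
  ∑ w ∈ s, ((O.keptDemand (e w) (t * m w) (δ w) (rin w) (rout w) L : ℤ) : ℝ) / (O.den : ℝ) * ((t : ℝ) * (m w : ℝ) * u w)

/-- **TIER-L1 KEPT MASS at dilation `t`**: `M(t) − Σ_w DD_w(t·m_w)·u_w` (exact information, no netting; `K_L1 = M − DD(datum)`, p522952).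
[claim: Mochizuki2012, status: disputed] -/
@[claim "Mochizuki2012" "disputed"]
def Output.keptL1At (O : Output) (s : Finset ι) (e m δ rin rout : ι → ℤ) (u : ι → ℝ) (L : ℕ) (t : ℕ) : ℝ :=
  O.massAt s m u L t - ∑ w ∈ s, ((O.exactDeficit (e w) (t * m w) (δ w) (rin w) (rout w) L : ℤ) : ℝ) * u w

/-- **LICENCE-ONLY RECOVERED-FRACTION PROFILE along the height ray** (p532994's `s ≥ 1`, read at the integer dilation `t = ⌊s⌋₊`): `K_L0(t)/M(t)`.
[claim: Mochizuki2012, status: disputed] -/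
@[claim "Mochizuki2012" "disputed"]
def Output.profileL0 (O : Output) (s : Finset ι) (e m δ rin rout : ι → ℤ) (u : ι → ℝ) (L : ℕ) : ℝ → ℝ :=
  fun σ => O.keptL0At s e m δ rin rout u L ⌊σ⌋₊ / O.massAt s m u L ⌊σ⌋₊

/-- **EXACT-TIER RECOVERED-FRACTION PROFILE along the height ray**: `K_L1(t)/M(t)` at `t = ⌊s⌋₊`. An object's D2 CLASS STATEMENT at the datum is
`NegExponent (O.profileL1 …)` (KILLED shape — BARRIER p531802 applies) or `DoorAt (O.profileL1 …)` (door shape). [claim: Mochizuki2012, status: disputed] -/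
@[claim "Mochizuki2012" "disputed"]
def Output.profileL1 (O : Output) (s : Finset ι) (e m δ rin rout : ι → ℤ) (u : ι → ℝ) (L : ℕ) : ℝ → ℝ :=
  fun σ => O.keptL1At s e m δ rin rout u L ⌊σ⌋₊ / O.massAt s m u L ⌊σ⌋₊

end Datum

/-! ## §1. Card `isogenous-theta-first-power` (O-35; object column of O-01/O-02/O-03): the `N`-isogenous theta at print's label points -/

section IsoTheta

open Literature.AnabelianGeometry.EtaleTheta Summit.ABC.IUTFork.Repair.RH.IsoThetaFaces

variable {𝕜 : Type*} [NormedField 𝕜]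

/-- **THE OBJECT (value level): `isoTheta q̈ N := Θ̈_{q̈^N}`** — the [EtTh] Prop 1.4 theta series with half-period `q̈^N` in place of `q̈`, i.e. the theta function
of the once-punctured `N`-ISOGENOUS Tate curve `X′_v = E̲_v ∖ {O_0}`, `E̲_v = 𝔾_m/q^{Nℤ}` (at `N = l`: the compactified (1, l-tors) cover of print's own [IUTchI] Def 3.1
(b)(e) = the local «GMS quotient» `E*_v` of [EssLgc] §3.3 (iii)/(vi-a), punctured ONLY at the zero-labelled cusp), to be READ AT PRINT's UNCHANGED label-`j` points
`Ü = q̈^j·ζ` ([IUTchII] Rmk 2.5.1 (ii) «±√−1·q^{j/2}»; card 43cf8ba6c06ec9a5 M1–M3, scratch `isoThetaVal q̈ ζ l j = isoTheta q̈ l (q̈^j·ζ)` adeafb32aa73f2e5). DICTIONARY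
(card §2, verbatim in meaning): period `q_X ↦ q_X^N`; divisor on the `Ÿ`-cusps = order 1 at `±q̈^{Nn}`, 0 elsewhere (δ_{n ≡ 0 (N)}); automorphy = print's `k = 4`
identity for `a ∈ N·ℤ` only; evaluation points, labels `1 … l⋆`, packets `(j+1)`, log-shell radii, `D` UNCHANGED ⇒ in REQB currency only k1 moves: pilot order
`|j|·m_q` after the reciprocal `l`-th root, demand `(|j| − 1)·m_q` (footprint `isoThetaFirstPower` below). A HYPOTHETICAL replacement of print's local theta datum
(knob «k0», census tag NEW-THEORY); nothing here says [IUTchI–III] admit it. [claim: Mochizuki2012, status: disputed] -/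
@[claim "Mochizuki2012" "disputed"]
def isoTheta (q2 : 𝕜) (N : ℕ) : 𝕜 → 𝕜 :=
  thetaDdot (q2 ^ N)

/-- `isoTheta q̈ 1 = Θ̈_{q̈}` — print's own function is the `N = 1` member. [folklore] -/
theorem isoTheta_one (q2 : 𝕜) : isoTheta q2 1 = thetaDdot q2 := by unfold isoTheta; rw [pow_one]

/-- **`R4_valueLawSub k N q̈ F` — THE RE-CUT VALUE-LEVEL REQUIREMENT** (card 43cf8ba6c06ec9a5 §5 R-A3 «typer note», verdict cb6fdd389d094aeb F3: «the typer's
proposed re-cut `R4_valueLawSub (N := l)` is inhabited»). reqb-typ-1's `R4_valueLaw k q̈ F` (p534392 §2) asks ONE function for (i′) zeros on `𝕜^×` exactly at the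
cusps `±q̈^ℤ` and (ii′) a factor of automorphy for the FULL lattice `q̈^ℤ` whose `q̈`-order law is `⌈|n|^{k/2}⌉` — UNINHABITED at `k ≠ 4` (`AxisCK1ValueLawNoGo.not_valueLaw_two /
_three`, p538071: a `q̈^ℤ`-cocycle forces the square law). The re-cut DECOUPLES the PERIOD lattice `(q̈^N)^ℤ` from the `N`-times-finer LABEL lattice `q̈^ℤ`:
(i″) zeros on `𝕜^×` exactly at `±(q̈^N)^n`, `n ∈ ℤ`; (ii″) print's `k = 4` automorphy clause VERBATIM for the period `q̈^N` (`‖c_n‖ = ‖q̈^N‖^{−n²}`); (iii″) the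
ABSOLUTE value law on the labels, `‖F(q̈^j·ζ)‖ = ‖q̈‖^{−⌈|j|^{k/2}⌉}` for every unit `ζ` and `0 < |j| < N` (absolute = «value = inverse coordinate up to 1-units»,
crit-1 D1; `SpecK1` (O1) consumes an absolute order). Print is the `(k, N) = (4, 1)` member ((iii″) vacuous there: `valueLawSub_four_one_of_valueLaw_four`); the card's
object is the `(2, l)` member (`isoTheta_valueLawSub`). A REQUIREMENT SHAPE in OUR currency — what a value-level object must satisfy —, not a reading of [EtTh].
[claim: Mochizuki2012, status: disputed] -/
@[claim "Mochizuki2012" "disputed"]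
def R4_valueLawSub (k N : ℕ) (q2 : 𝕜) (F : 𝕜 → 𝕜) : Prop :=
  (∀ U : 𝕜, U ≠ 0 → (F U = 0 ↔ ∃ n : ℤ, U = (q2 ^ N) ^ n ∨ U = -((q2 ^ N) ^ n))) ∧
    (∃ (c : ℤ → 𝕜) (w : ℤ → ℤ), (∀ n : ℤ, ‖c n‖ = ‖q2 ^ N‖ ^ (-(lawPow 4 n.natAbs))) ∧
      ∀ (n : ℤ) (U : 𝕜), U ≠ 0 → F ((q2 ^ N) ^ n * U) = c n * U ^ (w n) * F U) ∧
    ∀ ζ : 𝕜, ‖ζ‖ = 1 → ∀ j : ℤ, j ≠ 0 → |j| < N → ‖F (q2 ^ j * ζ)‖ = ‖q2‖ ^ (-(lawPow k j.natAbs))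

/-- CALIBRATION: print's value law (`R4_valueLaw 4`, p534392) IS the `(4, 1)` member of the re-cut family (the label clause is vacuous at `N = 1`). [folklore] -/
theorem valueLawSub_four_one_of_valueLaw_four {q2 : 𝕜} {F : 𝕜 → 𝕜} (h : R4_valueLaw 4 q2 F) : R4_valueLawSub 4 1 q2 F := by
  obtain ⟨h1, c, w, hc, hF⟩ := h
  refine ⟨fun U hU => by simpa only [pow_one] using h1 U hU, ⟨c, w, fun n => by simpa only [pow_one] using hc n, fun n U hU => ?_⟩, ?_⟩
  · simpa only [pow_one] using hF n U hU
  · intro ζ _ j hj hjN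
    exfalso
    have : (1 : ℤ) ≤ |j| := Int.one_le_abs hj
    push_cast at hjN
    omega

/-- **INHABITATION at `(k, N) = (2, l)` — the card's object meets the re-cut requirement** over every complete ultrametric normed field with `0 < ‖q̈‖ < 1`
(`1 ≤ l`): (i″) tree `thetaDdot_eq_zero_iff_of_norm_lt_one` at parameter `q̈^l` (PROVED, Jacobi triple product); (ii″) tree `R4_valueLaw_four_automorphy_thetaDdot` at
`q̈^l` (= the scratch's `isoTheta_periodAutomorphy`); (iii″) crit-1's `IsoThetaFaces.norm_isoTheta_abs` (p541305; R-A1 of the card, `lawPow 2 |j| = |j|`). So the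
re-typed value-level face of the κ′ = 1 doors is INHABITED where the full-lattice face is provably empty — typed ≠ a theory: R-A2/R-A3 below carry the door. [folklore] -/
theorem isoTheta_valueLawSub [CompleteSpace 𝕜] [IsUltrametricDist 𝕜] {q2 : 𝕜} (hq : ‖q2‖ < 1) (hq0 : q2 ≠ 0) {l : ℕ} (hl : 1 ≤ l) :
    R4_valueLawSub 2 l q2 (isoTheta q2 l) := by
  have hql0 : q2 ^ l ≠ 0 := pow_ne_zero l hq0
  have hql : ‖q2 ^ l‖ < 1 := by rw [norm_pow]; exact pow_lt_one₀ (norm_nonneg _) hq (by omega)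
  refine ⟨fun U hU => ?_, ?_, fun ζ hζ j hj hjl => ?_⟩
  · unfold isoTheta
    exact thetaDdot_eq_zero_iff_of_norm_lt_one hql hql0 hU
  · obtain ⟨c, w, hc, hF⟩ := R4_valueLaw_four_automorphy_thetaDdot (𝕜 := 𝕜) hql0
    exact ⟨c, w, hc, fun n U hU => hF n U hU⟩
  · unfold isoTheta
    rw [lawPow_two, Int.natCast_natAbs]
    exact norm_isoTheta_abs hq hq0 hζ hj hjl

/-- **«the re-cut value-level requirement `(k, N)` is REALISED»**: over every complete ultrametric normed field and every `q̈` with `0 < ‖q̈‖ < 1` SOME function meets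
`R4_valueLawSub k N q̈`. At `(2, l)`, `l ≥ 1`, it HOLDS (`valueLawSubRealised_two`, by `isoTheta q̈ l`); the `N = 1` members are p534392's full-lattice frame, whose
`k ∈ {2, 3, 5}` cases are killed by p538071 (`not_valueLaw_two / _three / _five`; cited, not re-derived here). HYPOTHESIS shape. [claim: Mochizuki2012, status: disputed] -/
@[claim "Mochizuki2012" "disputed"]
def ValueLawSubRealised (k N : ℕ) : Prop :=
  ∀ (𝕜 : Type) [NormedField 𝕜] [CompleteSpace 𝕜] [IsUltrametricDist 𝕜] (q2 : 𝕜), 0 < ‖q2‖ → ‖q2‖ < 1 →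
    ∃ F : 𝕜 → 𝕜, R4_valueLawSub k N q2 F

/-- `ValueLawSubRealised 2 l` HOLDS for every `l ≥ 1`, by `isoTheta q̈ l`. [folklore] -/
theorem valueLawSubRealised_two {l : ℕ} (hl : 1 ≤ l) : ValueLawSubRealised 2 l :=
  fun _ _ _ _ q2 hq0 hq => ⟨isoTheta q2 l, isoTheta_valueLawSub hq (norm_pos_iff.mp hq0) hl⟩

/-- **THE CELL FOOTPRINT of the isogenous theta**: law `|j| = lawPow 2` on the labels `≥ 1` (`lawPow_two`), `den = 1`, PRINT margins — the card's dictionary rows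
«evaluation points SAME · packets (j+1), labels 1…l⋆, R_in/R_out, D untouched ⇒ only k1 moves: f(j) = j, d_j = (j−1)m_q» — i.e. EXACTLY the doors' target
`Output.doorTarget 2` of O-01/O-02/O-03. [claim: Mochizuki2012, status: disputed] -/
@[claim "Mochizuki2012" "disputed"]
def isoThetaFirstPower : Output :=
  Output.doorTarget 2

variable {ι : Type*}

/-- **«the isogenous theta MEETS the κ′ = 1 spec at target `μ₀`» at a datum**, the typable part: (cell) its footprint meets `SpecK1 2 μ₀` (p538398) at the datum, AND
(value level) the re-cut requirement `(2, l)` is realised. The card's PRINT-SIDE residuals are NOT typable in the frozen interface and are recorded here by name only: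
R-A2 «[EtTh] §2 rigidity (`RigidData`, `Cor219_i_*`) for `(X′, Θ′)` reached from `Π_v` through the cusp-filling quotient `Π^tp_X ↠ Π^tp_{X′}`» (instance-of-print for
`X′` alone; the QUOTIENT STEP has no carrier in the tree) and R-A3 «a [IUTchII] Cor 2.8-type restriction algorithm for ONE factor `Θ′` of the `F_l`-norm `∏_t Θ′_t`
(print's pilot, crit-1 D2 / `IsoThetaFaces.orbitLaw_l13`) under the label-0-moving Δ_C-conjugation of Cor 3.5 (i) that PERMUTES the factors» (verdict F4: located
head-on at Rmk 4.7.3 (ii) p.144 / Rmk 4.7.4 p.146; NEW-THEORY k0). HYPOTHESIS about a hypothetical datum; located ≠ adjudicated. [claim: Mochizuki2012, status: disputed] -/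
@[claim "Mochizuki2012" "disputed"]
def isoThetaFirstPower_meetsSpec (l : ℕ) (μ₀ : ℝ) (s : Finset ι) (e m δ rin rout : ι → ℤ) (u : ι → ℝ) (L : ℕ) : Prop :=
  isoThetaFirstPower.MeetsSpecK1 2 μ₀ s e m δ rin rout u L ∧ ValueLawSubRealised 2 l

/-- The typable part of «meets the spec» REDUCES to the datum's MEETS word `R1_meets 2 μ₀` (p534392; bed words of record O-01/O-02/O-03: MEETS 133/133 · 79/79 at
`μ₀ ∈ {27/64, ½, ¾}`) once `l ≥ 1`: the footprint is the door's target (`meetsSpecK1_doorTarget_iff`) and the value-level requirement is realised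
(`valueLawSubRealised_two`). So the door's open content is R-A2 ∧ R-A3 (print side), not cell arithmetic. [folklore] -/
theorem isoThetaFirstPower_meetsSpec_iff {l : ℕ} (hl : 1 ≤ l) (μ₀ : ℝ) (s : Finset ι) (e m δ rin rout : ι → ℤ) (u : ι → ℝ) (L : ℕ) :
    isoThetaFirstPower_meetsSpec l μ₀ s e m δ rin rout u L ↔ R1_meets 2 μ₀ s e m δ rin rout u L := by
  unfold isoThetaFirstPower_meetsSpec isoThetaFirstPower
  rw [Output.meetsSpecK1_doorTarget_iff]
  exact ⟨fun h => h.1, fun h => ⟨h, valueLawSubRealised_two hl⟩⟩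

/-- **D2 CLASS STATEMENT of the isogenous theta at a datum: KILLED shape** — its exact-tier recovered-fraction profile along the height ray `m_q ↦ t·m_q` has a
NEGATIVE exponent (`NegExponent`, p532994). EXPECTED PROVABLE, not proved here: the object is weights-only (law homogeneous of degree 1 in `m_q`, price law-free
and height-free), so EXP-6 p533167 (`keptSlack_le_budget_of_at_one`: `K_L1(t) ≤` law-free budget ⇒ exponent `−1`) and BARRIER p531802 apply verbatim — verdict F5
CONCUR, card §0 (d) «NOT a rescue by itself». The class change the κ′ = 1 doors need is owed to S5 / `downstream_vacuous_of_window` (p536146), not to this object.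
[claim: Mochizuki2012, status: disputed] -/
@[claim "Mochizuki2012" "disputed"]
def isoThetaFirstPower_classStatement (s : Finset ι) (e m δ rin rout : ι → ℤ) (u : ι → ℝ) (L : ℕ) : Prop :=
  NegExponent (isoThetaFirstPower.profileL1 s e m δ rin rout u L)

end IsoTheta

end Summit.ABC.IUTFork.Repair.RH.Round4Objects

end
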